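import Literature.MathematicalPhysics.QuantumLattice.WilsonPositivityDomain

/-!
# Crux `CoerciveSea` (hinge of route `NestedDissectionSea`, stmt-QuantumFields-13901), negative side, 1/4 —
# Seiler positivity on BOTH sides of the hopping band

Support file of the standing disprover (cdisprove seat) of the hinge crux `CoerciveSea`.
`fermionDet_wilsonDirac_re_pos_of_four_lt_abs`: for every unitary colour representation, every
periodic four-torus, every gauge field and every bare mass with `|m + 4| > 4` — `m > 0` (the tree's
`fermionDet_wilsonDirac_re_pos`, Seiler 1982 apud Rothe 2005 Ch. 12) OR `m < −8` — the `r = 1`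
Wilson determinant is a positive real.  Same homotopy `t ↦ 1 − (t/(m+4))K` (`‖K‖ ≤ 4 < |m+4|`,
Neumann; real by γ₅-hermiticity; IVT), plus: the Wilson index set `sites × colours × 4 spins` has
EVEN cardinality, so `(m+4)^n > 0` also for `m + 4 < 0`.  Consumed by `PinWindow.lean` (the pin
clause of the crux is empty off `[−8, 0]`). Standard material. [folklore]
-/

noncomputable section

open scoped BigOperators ComplexConjugate Kronecker
open MeasureTheory Filter Matrix
open Literature.MathematicalPhysics.QuantumLattice Literature.MathematicalPhysics.QuantumFieldTheory
  Literature.Probability.LatticeModels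

namespace Summit.QuantumFields.QCD.Theorems.CoerciveSeaNegative

/-! ## Part A.1 — Seiler positivity on both sides: `Re det D_W(U,m,1) > 0` for `|m + 4| > 4` -/

section DetPos

variable {L N : ℕ} [NeZero L] {G : Type*} [Group G] (ρ : G →* Matrix (Fin N) (Fin N) ℂ)

section L2

open scoped Matrix.Norms.L2Operator

/-- Neumann: for `|m+4| > 4` and `t ∈ [0,1]` the homotopy matrix `1 − (t/(m+4)) K` is a unit
(`‖K‖ ≤ 4`). [folklore] -/
theorem isUnit_segMatrix_of_four_lt_abs (hρ : ∀ g, ρ g ∈ Matrix.unitaryGroup (Fin N) ℂ)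
    (U : GaugeConfig 4 L G) {m t : ℝ} (hm : 4 < |m + 4|) (ht0 : 0 ≤ t) (ht1 : t ≤ 1) :
    IsUnit ((1 - ((t / (m + 4) : ℝ) : ℂ) • ∑ μ, wilsonHop ρ U μ)) := by
  have hK := l2_opNorm_sum_wilsonHop_le ρ hρ U
  have h4 : (0 : ℝ) < |m + 4| := by linarith
  have hnorm : ‖((t / (m + 4) : ℝ) : ℂ) • ∑ μ, wilsonHop ρ U μ‖ < 1 := by
    rw [norm_smul, Complex.norm_real, Real.norm_eq_abs, abs_div, abs_of_nonneg ht0]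
    calc t / |m + 4| * ‖∑ μ, wilsonHop ρ U μ‖ ≤ 1 / |m + 4| * 4 := by
          apply mul_le_mul _ hK (norm_nonneg _) (by positivity)
          exact div_le_div_of_nonneg_right ht1 h4.le
      _ < 1 := by
          rw [div_mul_eq_mul_div, one_mul, div_lt_one h4]; exact hm
  exact ⟨Units.oneSub _ hnorm, rfl⟩

/-- Hence `det (1 − (t/(m+4)) K) ≠ 0` on the segment. [folklore] -/
theorem det_segMatrix_ne_zero_of_four_lt_abs (hρ : ∀ g, ρ g ∈ Matrix.unitaryGroup (Fin N) ℂ)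
    (U : GaugeConfig 4 L G) {m t : ℝ} (hm : 4 < |m + 4|) (ht0 : 0 ≤ t) (ht1 : t ≤ 1) :
    ((1 - ((t / (m + 4) : ℝ) : ℂ) • ∑ μ, wilsonHop ρ U μ)).det ≠ 0 :=
  ((Matrix.isUnit_iff_isUnit_det _).mp (isUnit_segMatrix_of_four_lt_abs ρ hρ U hm ht0 ht1)).ne_zero

end L2

omit [NeZero L] in
/-- For `t ≠ 0`, `m + 4 ≠ 0` the homotopy matrix is `t/(m+4)` times the Wilson–Dirac matrix at
bare mass `(m+4)/t − 4`. [folklore] -/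
theorem segMatrix_eq_smul_wilsonDirac' (hρ : ∀ g, ρ g ∈ Matrix.unitaryGroup (Fin N) ℂ)
    (U : GaugeConfig 4 L G) {m t : ℝ} (hm : m + 4 ≠ 0) (ht : t ≠ 0) :
    (1 - ((t / (m + 4) : ℝ) : ℂ) • ∑ μ, wilsonHop ρ U μ) =
      ((t / (m + 4) : ℝ) : ℂ) • wilsonDirac ρ U ((m + 4) / t - 4) 1 := by
  rw [wilsonDirac_eq_sub_sum_wilsonHop ρ hρ, smul_sub, smul_smul, ← Complex.ofReal_mul,
    show t / (m + 4) * ((m + 4) / t - 4 + 4) = 1 by field_simp; ring, Complex.ofReal_one, one_smul]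

/-- `det (1 − (t/(m+4)) K)` is real (γ₅-hermiticity at the rescaled mass; `= 1` at `t = 0`).
[folklore] -/
theorem det_segMatrix_im' (hρ : ∀ g, ρ g ∈ Matrix.unitaryGroup (Fin N) ℂ)
    (U : GaugeConfig 4 L G) {m t : ℝ} (hm : m + 4 ≠ 0) :
    (((1 - ((t / (m + 4) : ℝ) : ℂ) • ∑ μ, wilsonHop ρ U μ)).det).im = 0 := by
  rcases eq_or_ne t 0 with h | ht
  · subst h; simp
  · rw [segMatrix_eq_smul_wilsonDirac' ρ hρ U hm ht, det_smul]
    have hreal := fermionDet_wilsonDirac_im_holds (L := L) ρ hρ U ((m + 4) / t - 4) 1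
    set d := (wilsonDirac ρ U ((m + 4) / t - 4) 1).det with hd
    have hd' : d = ((d.re : ℝ) : ℂ) := Complex.ext (by simp) (by simpa using hreal)
    rw [hd', ← Complex.ofReal_pow, ← Complex.ofReal_mul, Complex.ofReal_im]

/-- The Wilson index set `sites × colours × spins` has EVEN cardinality (four spins). [folklore] -/
theorem even_card_wilsonIndex :
    Even (Fintype.card (TorusSite 4 L × Fin N × Fin 4)) := by
  rw [Fintype.card_prod, Fintype.card_prod, Fintype.card_fin]
  exact (show Even 4 from ⟨2, rfl⟩).mul_left _ |>.mul_left _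

/-- **Seiler positivity on both sides of the hopping band.** For every unitary colour
representation, every periodic four-torus, every gauge field and every bare mass with
`|m + 4| > 4` — i.e. `m > 0` (the tree's `fermionDet_wilsonDirac_re_pos`) OR `m < −8` — the Wilson
determinant is a positive real: along `t ↦ 1 − (t/(m+4))K` the determinant is real, continuous,
non-zero (Neumann, `‖K‖ ≤ 4 < |m+4|`) and `1` at `t = 0`, so positive at `t = 1`; and
`det D_W = (m+4)^n det(1 − K/(m+4))` with `n = #sites·N·4` EVEN, so `(m+4)^n > 0` also for
`m + 4 < 0`. Consequence for the crux: the pin event `Re det D_W(U, μ₀, 1) < 0` is EMPTY unless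
`μ₀ ∈ [−8, 0]`. [folklore] -/
theorem fermionDet_wilsonDirac_re_pos_of_four_lt_abs (hρ : ∀ g, ρ g ∈ Matrix.unitaryGroup (Fin N) ℂ)
    (U : GaugeConfig 4 L G) {m : ℝ} (hm : 4 < |m + 4|) :
    0 < (fermionDet (wilsonDirac ρ U m 1)).re := by
  have hm4 : m + 4 ≠ 0 := fun h => by rw [h, abs_zero] at hm; linarith
  set g : ℝ → ℝ := fun t => (((1 - ((t / (m + 4) : ℝ) : ℂ) • ∑ μ, wilsonHop ρ U μ)).det).re
    with hgdef
  have hg : Continuous g := Complex.continuous_re.comp (continuous_det_segMatrix ρ U m)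
  have hg0 : g 0 = 1 := by simp [hgdef]
  have hne : ∀ t ∈ Set.Icc (0 : ℝ) 1, g t ≠ 0 := by
    intro t ht h0
    apply det_segMatrix_ne_zero_of_four_lt_abs ρ hρ U hm ht.1 ht.2
    exact Complex.ext (by simpa [hgdef] using h0) (by simpa using det_segMatrix_im' ρ hρ U hm4)
  have hg1 : 0 < g 1 := by
    refine lt_of_not_ge fun hle => ?_
    have hmem : (0 : ℝ) ∈ Set.Icc (g 1) (g 0) := ⟨hle, by rw [hg0]; norm_num⟩
    obtain ⟨t, ht, ht0⟩ := intermediate_value_Icc' zero_le_one hg.continuousOn hmem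
    exact hne t ht ht0
  have hD : wilsonDirac ρ U m 1 =
      ((m + 4 : ℝ) : ℂ) • (1 - ((1 / (m + 4) : ℝ) : ℂ) • ∑ μ, wilsonHop ρ U μ) := by
    rw [smul_sub, smul_smul, ← Complex.ofReal_mul,
      show (m + 4) * (1 / (m + 4)) = 1 by field_simp, Complex.ofReal_one, one_smul,
      wilsonDirac_eq_sub_sum_wilsonHop ρ hρ]
  have hdet : fermionDet (wilsonDirac ρ U m 1) =
      (((m + 4) ^ Fintype.card (TorusSite 4 L × Fin N × Fin 4) * g 1 : ℝ) : ℂ) := by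
    rw [fermionDet, hD, det_smul]
    have him := det_segMatrix_im' ρ hρ U (t := 1) hm4
    set d := ((1 - ((1 / (m + 4) : ℝ) : ℂ) • ∑ μ, wilsonHop ρ U μ)).det with hd
    have hd' : d = ((d.re : ℝ) : ℂ) := Complex.ext (by simp) (by simpa using him)
    rw [hd', ← Complex.ofReal_pow, ← Complex.ofReal_mul]
  rw [hdet, Complex.ofReal_re]
  exact mul_pos (even_card_wilsonIndex.pow_pos hm4) hg1

/-- The two corners in one statement: `m > 0 ∨ m < −8` gives a positive determinant. [folklore] -/
theorem fermionDet_wilsonDirac_re_pos_of_pos_or_lt (hρ : ∀ g, ρ g ∈ Matrix.unitaryGroup (Fin N) ℂ)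
    (U : GaugeConfig 4 L G) {m : ℝ} (hm : 0 < m ∨ m < -8) :
    0 < (fermionDet (wilsonDirac ρ U m 1)).re := by
  refine fermionDet_wilsonDirac_re_pos_of_four_lt_abs ρ hρ U ?_
  rcases hm with h | h
  · rw [abs_of_pos (by linarith)]; linarith
  · rw [abs_of_neg (by linarith)]; linarith

end DetPos

end Summit.QuantumFields.QCD.Theorems.CoerciveSeaNegative

end
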